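import Summits.SmoothPoincare4.SmoothPoincare4.Theses.EntropyRung
import Summits.SmoothPoincare4.SmoothPoincare4.Theses.BachCriticalElement
import Summits.SmoothPoincare4.SmoothPoincare4.Theses.PIC
import Summits.SmoothPoincare4.SmoothPoincare4.Theses.PscCorkFillIn
import Literature.Topology.FourManifolds.HomotopyS4CompactProofs
import Literature.Topology.FourManifolds.HomotopySpheres
import HarnessLib

/-!
# `EntropyRung.SubcylindricalExistence` is PSC-hard UNCONDITIONALLY (rung-free cross-route edges
to `BachCriticalElement.PscOnHomotopySpheres` and `PIC.PicPscV2`)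

The crux ENT (item stmt-SmoothPoincare4-10871) of route EntropyRung asks, for every closed smooth
`M ≃ₕ S⁴`, for a Riemannian metric `g` with Levi-Civita connection, `scal_g > 0` everywhere AND
Perelman entropy `ν(g) > ν_cyl`. The tree already records that ENT is the summit MODULO THE RUNG
(`Theorems.subcylindricalExistence_iff_spc4`, `Negative.Logic`), i.e. conditionally on the open item
stmt-SmoothPoincare4-10869. This file records the complementary RUNG-FREE lower bound on its hardness:
forgetting the entropy clause, ENT implies VERBATIM the positive-scalar-curvature cruxes of two other
routes on this summit,

* `BachCriticalElement.PscOnHomotopySpheres` (stmt-SmoothPoincare4-4395, `[difficulty: open-problem]`: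
  PSC on a GIVEN smooth homotopy 4-sphere — Gromov–Lawson/Stolz reach dimension 4 only up to
  homeomorphism), and
* `PIC.PicPscV2` (stmt-SmoothPoincare4-0442, the same content over `HomotopySphere 4`),

with no hypothesis at all. So a refutation of either PSC crux refutes ENT, and no proof of ENT can be
cheaper than a proof of PSC on unidentified homotopy 4-spheres — independently of Perelman/Bamler.
The only work is discharging ENT's extra binders `[CompactSpace M] [T3Space M] [MeasurableSpace M]
[BorelSpace M]` on a bare `M ≃ₕ S⁴`: compactness is the PROVED tree theorem
`compactSpace_of_homotopyEquiv_sphere_four_holds` (Hatcher, Prop. 3.29 ff.), compact Hausdorff spaces are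
T₃ (Mathlib instances), and the Borel σ-algebra serves as the measurable structure (ENT holds for every
Borel structure, in particular this one). Everything is proved; no definition, no named fact, no `sorry`.

References: [Perelman2002Entropy] §3 (ν); [KumarSen2025] Obs. 9 (PSC on homotopy 4-spheres is open);
[HatcherAT2002] Prop. 3.29.

Appended (same seat): the third PSC crux of the summit with this content,
`PscCorkFillIn.PscAllHomotopySpheres` (route PscCorkFillIn; verbatim the statement of `PIC.PicPscV2`),
follows from ENT by the same binder discharge — `pscAllHomotopySpheres_of_subcylindricalExistence`.
-/

noncomputable section

-- the registered namespace `Summit.SmoothPoincare4.SmoothPoincare4.Theorems` repeats a component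
set_option linter.dupNamespace false

open scoped Manifold ContDiff Topology

namespace Summit.SmoothPoincare4.SmoothPoincare4.Theorems

/-- **ENT ⇒ PSC on homotopy 4-spheres (route BachCriticalElement's crux), unconditionally.** For a bare
closed smooth `M ≃ₕ S⁴` (summit binder), supply `CompactSpace` from the proved Hatcher fact, `T3Space`
from compact + Hausdorff, and the Borel σ-algebra; then ENT's metric has `scal > 0`. [folklore] -/
theorem pscOnHomotopySpheres_of_subcylindricalExistence :
    _root_.Summit.SmoothPoincare4.SmoothPoincare4.Theses.EntropyRung.SubcylindricalExistence →
      _root_.Summit.SmoothPoincare4.SmoothPoincare4.Theses.BachCriticalElement.PscOnHomotopySpheres := by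
  intro hEnt M _ _ _ _ _ e
  haveI : CompactSpace M :=
    Literature.Topology.FourManifolds.compactSpace_of_homotopyEquiv_sphere_four_holds M e
  letI : MeasurableSpace M := borel M
  haveI : BorelSpace M := ⟨rfl⟩
  obtain ⟨g, hLC, hg, hR, -⟩ := hEnt M e
  exact ⟨g, hLC, hg, hR⟩

/-- **ENT ⇒ route PIC's crux `PicPscV2`, unconditionally**: the same edge over the bundled
`HomotopySphere 4` (whose carrier is compact by definition; the homotopy equivalence is extracted from
`nonempty_homotopyEquiv` by choice, harmless since the goal is a proposition). [folklore] -/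
theorem picPscV2_of_subcylindricalExistence :
    _root_.Summit.SmoothPoincare4.SmoothPoincare4.Theses.EntropyRung.SubcylindricalExistence →
      _root_.Summit.SmoothPoincare4.SmoothPoincare4.Theses.PIC.PicPscV2 := by
  intro hEnt S
  obtain ⟨e⟩ := S.nonempty_homotopyEquiv
  letI : MeasurableSpace S.carrier := borel S.carrier
  haveI : BorelSpace S.carrier := ⟨rfl⟩
  obtain ⟨g, hLC, hg, hR, -⟩ := hEnt S.carrier e
  exact ⟨g, hLC, hg, hR⟩

/-- **ENT ⇒ route PscCorkFillIn's crux `PscAllHomotopySpheres`, unconditionally**: that crux is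
verbatim the statement of `PIC.PicPscV2` (every `HomotopySphere 4` carries a Riemannian metric with
Levi-Civita connection and `scal > 0`), so the previous edge applies as it stands. [folklore] -/
theorem pscAllHomotopySpheres_of_subcylindricalExistence :
    _root_.Summit.SmoothPoincare4.SmoothPoincare4.Theses.EntropyRung.SubcylindricalExistence →
      _root_.Summit.SmoothPoincare4.SmoothPoincare4.Theses.PscCorkFillIn.PscAllHomotopySpheres :=
  picPscV2_of_subcylindricalExistence

end Summit.SmoothPoincare4.SmoothPoincare4.Theorems

end
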